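import Literature.Barriers.CriticalPhenomena.LongRangeDiscontinuityProofs
import Literature.Probability.Percolation.LongRangeGoodBlocksCovering
import Literature.Probability.Percolation.LongRangeGoodBlocksShift
import Literature.Probability.Percolation.LongRangeRenormSums
import Literature.Probability.LatticeModels.ProdBernoulliDecoupling
import Mathlib.Algebra.Order.Ring.Int
import HarnessLib

/-!
# The `1/|x-y|²` family: the renormalisation inequality for bad blocks (DGT Lemma 2)

Proofs-only companion of `Literature.Barriers.CriticalPhenomena.LongRangeDiscontinuity`, second
step of the discharge of `NewmanSchulman1986_transition` (existence of a percolative phase of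
Aizenman–Newman's family (1.7), `K_1 = p`, `K_n = 1 - e^{-β/n²}`) along Duminil-Copin–Garban–
Tassion, *Long-range models in 1D revisited*, AIHP 60 (2024), §2.3. The configuration-wise
combinatorics (blocks, good blocks, merging, the covering lemma, `E_i`, `𝐂^±`) are
`Literature.Probability.Percolation.LongRangeGoodBlocks*`; here the measure enters:

* `longRangePercolation_real_bad_add` — translation invariance of `P[B^j_K is θ-bad]` in `j`
  for every model `longRangePercolation K`;
* `real_forall_mk_notMem_eq_exp` — for the family, all edges between `S` and `T` (at mutual
  distances `≥ 2`) are closed with probability `exp(-β Σ_{x ∈ S, y ∈ T} (y-x)^{-2})` (DGT (2.7));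
* `real_isolBad_inter_bad_le` — the conditional estimate (2.9) integrated:
  `P[E_i ∩ {B_{CK} θ'-bad}] ≤ exp(-β θ² Λ_N) · P[B^i_K θ-bad]`, `Λ_N = Σ_{m,m'<N} (3+m+m')^{-2}`,
  `2N ≤ C - |i| - 1`, by conditioning on `(𝐂⁻, 𝐂⁺)` (`prodBernoulli_real_inter_memDep_le`) and the
  block-by-block bound `sq_mul_pairSum_le_blockSum`;
* `real_twoBad_le` — `P[two disjoint bad K-blocks in B_{CK}] ≤ 4C² u²` when every `K`-block is
  bad with probability `≤ u` (independence of disjoint blocks and the union bound; DGT (2.5)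
  with `binom(2C-1, 2) ≤ 2C²` replaced by the cruder `(2C-1)² ≤ 4C²`).

The summation over `i` and the choice of `C₀` (DGT Lemma 2 proper) and the multi-scale
induction (Thm. 1(i)) follow in `LongRangeTransition.lean`.

## References

* H. Duminil-Copin, C. Garban, V. Tassion, *Long-range models in 1D revisited*, AIHP 60 (2024)
  232–241, arXiv:2011.04642: §2.3, Lemma 2 and its proof ((2.4)–(2.9)).
* M. Aizenman, C. M. Newman, Comm. Math. Phys. 107 (1986) 611–647: §1 (1.7).
-/

noncomputable section

open scoped Classical

namespace Literature.Barriers.CriticalPhenomena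

open _root_.MeasureTheory Finset unitInterval Literature.Probability.LatticeModels
  Literature.Probability.Percolation
open scoped ENNReal

/-! ### Translation invariance -/

/-- The edge probabilities `{x, y} ↦ K_{|x-y|}` of `longRangePercolation K` are invariant under
every translation of `ℤ`. [cite: AizenmanNewman1986, §1 (1.1) ("translation invariant")] -/
theorem lrParam_sym2Equiv_addRight (K : ℕ → unitInterval) (s : ℤ) (z : Sym2 ℤ) :
    Sym2.lift ⟨fun x y : ℤ => K (x - y).natAbs, fun x y => by
        show K (x - y).natAbs = K (y - x).natAbs
        rw [← Int.natAbs_neg, neg_sub]⟩ (sym2Equiv (Equiv.addRight s) z) =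
      Sym2.lift ⟨fun x y : ℤ => K (x - y).natAbs, fun x y => by
        show K (x - y).natAbs = K (y - x).natAbs
        rw [← Int.natAbs_neg, neg_sub]⟩ z := by
  induction z using Sym2.ind with
  | h a b =>
    rw [sym2Equiv_mk, Sym2.lift_mk, Sym2.lift_mk]
    simp only [Equiv.coe_addRight]
    congr 2
    ring

/-- **Translation invariance of the bad-block probability**: in any model
`longRangePercolation K`, `P[B^{j+t}_{K'} is θ-bad] = P[B^j_{K'} is θ-bad]`.
[cite: DuminilcopinGarbanTassion2024, §2.2 (p_{β,λ}(K,θ) := ℙ[B_K is θ-bad])] -/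
theorem longRangePercolation_real_bad_add (K : ℕ → unitInterval) (K' : ℕ) (θ : ℝ) (j t : ℤ) :
    (longRangePercolation K).real (bad K' θ (j + t)) = (longRangePercolation K).real (bad K' θ j) := by
  unfold longRangePercolation
  exact prodBernoulli_real_bad_add _ (fun z => lrParam_sym2Equiv_addRight K _ z) θ j

/-- Every block is bad with the probability of the block `B^0_{K'}`. [folklore] -/
theorem longRangePercolation_real_bad_eq (K : ℕ → unitInterval) (K' : ℕ) (θ : ℝ) (j : ℤ) :
    (longRangePercolation K).real (bad K' θ j) = (longRangePercolation K).real (bad K' θ 0) := by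
  have := longRangePercolation_real_bad_add K K' θ 0 j
  rwa [zero_add] at this

/-! ### Closed cylinders for the family -/

/-- An edge of length `n ≥ 2` of the family (1.7) is closed with probability `e^{-β/n²}`:
for `x + 2 ≤ y`, `1 - K_{|x-y|} = exp(-β/(y-x)²)`. [cite: AizenmanNewman1986, §1 (1.7)] -/
theorem one_sub_param_anFamily (β : ℝ) (hβ : 0 ≤ β) (p : unitInterval) {x y : ℤ} (hxy : x + 2 ≤ y) :
    1 - ((Sym2.lift ⟨fun x y : ℤ => anFamily β hβ p (x - y).natAbs, fun x y => by
        show anFamily β hβ p (x - y).natAbs = anFamily β hβ p (y - x).natAbs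
        rw [← Int.natAbs_neg, neg_sub]⟩ s(x, y) : unitInterval) : ℝ) =
      Real.exp (-β / ((y : ℝ) - x) ^ 2) := by
  rw [Sym2.lift_mk]
  simp only
  rw [coe_anFamily_of_two_le β hβ p (by omega), Nat.cast_natAbs, Int.cast_abs, Int.cast_sub, sq_abs]
  ring_nf

/-- **All edges between `S` and `T` are closed with probability `exp(-β Σ (y-x)^{-2})`** when
every `y ∈ T` lies at least `2` to the right of every `x ∈ S` (DGT (2.7):
`P(𝐂⁻, 𝐂⁺) := ∏_{x ∈ 𝐂⁻} ∏_{y ∈ 𝐂⁺} e^{-β J_{x,y}} = exp[-β Σ_a Σ_b J_{x_a, y_b}]`).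
[cite: DuminilcopinGarbanTassion2024, §2.3 (proof of Lemma 2, (2.7))] -/
theorem real_forall_mk_notMem_eq_exp (β : ℝ) (hβ : 0 ≤ β) (p : unitInterval) {S T : Finset ℤ}
    (hST : ∀ x ∈ S, ∀ y ∈ T, x + 2 ≤ y) :
    (longRangePercolation (anFamily β hβ p)).real {ω | ∀ x ∈ S, ∀ y ∈ T, s(x, y) ∉ ω} =
      Real.exp (-(β * ∑ x ∈ S, ∑ y ∈ T, 1 / ((y : ℝ) - x) ^ 2)) := by
  have hdisj : Disjoint S T := by
    rw [Finset.disjoint_left]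
    intro x hx hx'
    have := hST x hx x hx'
    omega
  unfold longRangePercolation
  rw [prodBernoulli_real_forall_mk_notMem _ hdisj, mul_sum, ← sum_neg_distrib, Real.exp_sum]
  refine prod_congr rfl fun x hx => ?_
  rw [mul_sum, ← sum_neg_distrib, Real.exp_sum]
  refine prod_congr rfl fun y hy => ?_
  rw [one_sub_param_anFamily β hβ p (hST x hx y hy)]
  congr 1
  ring

/-! ### The conditional estimate for `F_i` -/

/-- The event "all edges between `S` and `T` are closed" is determined by those edges.
[folklore] -/
theorem determinedBy_forall_mk_notMem (S T : Finset ℤ) :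
    DeterminedBy {ω : BondConfig ℤ | ∀ x ∈ S, ∀ y ∈ T, s(x, y) ∉ ω}
      (↑((S ×ˢ T).image fun q : ℤ × ℤ => s(q.1, q.2)) : Set (Sym2 ℤ)) := by
  rw [determinedBy_iff]
  intro ω ω' h
  simp only [Set.mem_setOf_eq]
  have key : ∀ x ∈ S, ∀ y ∈ T, (s(x, y) ∈ ω ↔ s(x, y) ∈ ω') := by
    intro x hx y hy
    have hz : s(x, y) ∈ (↑((S ×ˢ T).image fun q : ℤ × ℤ => s(q.1, q.2)) : Set (Sym2 ℤ)) := by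
      rw [Finset.mem_coe, Finset.mem_image]
      exact ⟨(x, y), Finset.mem_product.2 ⟨hx, hy⟩, rfl⟩
    constructor
    · intro h1; exact ((Set.ext_iff.1 h _).1 ⟨h1, hz⟩).1
    · intro h1; exact ((Set.ext_iff.1 h _).2 ⟨h1, hz⟩).1
  constructor
  · intro h1 x hx y hy h2; exact h1 x hx y hy ((key x hx y hy).2 h2)
  · intro h1 x hx y hy h2; exact h1 x hx y hy ((key x hx y hy).1 h2)

/-- **The conditional estimate integrated** (DGT (2.6)–(2.9)): for `3 ≤ C₀`, `|i| ≤ C - C₀`,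
`θ' = θ - C₀/C`, `3/4 < θ ≤ 1` and `2N ≤ C - |i| - 1`,
`P[E_i ∩ {B_{CK} is θ'-bad}] ≤ exp(-β θ² Λ_N) · P[B^i_K is θ-bad]`,
`Λ_N = Σ_{m, m' < N} (3 + m + m')^{-2}`. Proof as printed: on `F_i` no edge joins `𝐂⁻` to `𝐂⁺`
(`forall_not_mem_of_isolBad`); conditionally on `(𝐂⁻, 𝐂⁺)` — a statistic reading only the
edges inside the `K`-blocks, while the edges from `𝐂⁻` to `𝐂⁺` are longer than `2K` — the
probability that all these edges are closed is `exp(-β Σ_{x ∈ 𝐂⁻, y ∈ 𝐂⁺} (y-x)^{-2})`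
(`real_forall_mk_notMem_eq_exp`), at most `exp(-βθ²Λ_N)` because `𝐂⁻ ⊇ 𝐂(B^{i-2-2m}_K)` and
`𝐂⁺ ⊇ 𝐂(B^{i+2+2m'}_K)` for `m, m' < N` (`sq_mul_pairSum_le_blockSum`); integrate
(`prodBernoulli_real_inter_memDep_le`) and use `ℙ[E_i] ≤ ℙ[B^i_K bad]`.
[cite: DuminilcopinGarbanTassion2024, §2.3 (proof of Lemma 2, (2.6)–(2.9))] -/
theorem real_isolBad_inter_bad_le (β : ℝ) (hβ : 0 ≤ β) (p : unitInterval) {K : ℕ} (hK : 1 ≤ K)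
    {θ : ℝ} (hθ : 3 / 4 < θ) (hθ1 : θ ≤ 1) {C C₀ : ℕ} (hC₀ : 3 ≤ C₀) {i : ℤ}
    (hi1 : -((C : ℤ) - C₀) ≤ i) (hi2 : i ≤ (C : ℤ) - C₀) {N : ℕ} (hN : 2 * (N : ℤ) ≤ (C : ℤ) - |i| - 1) :
    (longRangePercolation (anFamily β hβ p)).real (isolBad K θ C i ∩ bad (C * K) (θ - C₀ / C) 0) ≤
      Real.exp (-(β * θ ^ 2 * ∑ m ∈ range N, ∑ m' ∈ range N, 1 / ((3 : ℝ) + m + m') ^ 2)) *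
        (longRangePercolation (anFamily β hβ p)).real (bad K θ i) := by
  have hiabs := abs_le.2 ⟨by linarith [hi1], hi2⟩
  have hi3 : -(C : ℤ) + 3 ≤ i := by omega
  have hi4 : i ≤ (C : ℤ) - 3 := by omega
  set a : ℤ := -(C : ℤ) + 1 with ha
  set b : ℤ := (C : ℤ) - 1 with hb
  set A := isolBad K θ C i with hA
  set Ψ : BondConfig ℤ → Finset ℤ × Finset ℤ := fun ω =>
    (chainCluster K θ a (i - 2) ω, chainCluster K θ (i + 2) b ω) with hΨ
  set E : Finset ℤ × Finset ℤ → Set (BondConfig ℤ) := fun ST =>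
    {ω | ∀ x ∈ ST.1, ∀ y ∈ ST.2, s(x, y) ∉ ω} with hE
  set F : Finset (Sym2 ℤ) := (chainEdges_finite K a b).toFinset with hF
  set Λ : ℝ := ∑ m ∈ range N, ∑ m' ∈ range N, 1 / ((3 : ℝ) + m + m') ^ 2 with hΛ
  set q : ℝ := Real.exp (-(β * θ ^ 2 * Λ)) with hq
  have hFcoe : (↑F : Set (Sym2 ℤ)) = chainEdges K a b := (chainEdges_finite K a b).coe_toFinset
  -- `F_i ⊆ A ∩ {no edge from 𝐂⁻ to 𝐂⁺}`
  have hsub : A ∩ bad (C * K) (θ - C₀ / C) 0 ⊆ A ∩ {ω | ω ∈ E (Ψ ω)} := fun ω hω =>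
    ⟨hω.1, forall_not_mem_of_isolBad hK hθ hθ1 hC₀ hi1 hi2 hω.1 hω.2⟩
  -- the good blocks on `E_i`
  have hgoodL : ∀ ω ∈ A, ∀ j, a ≤ j → j ≤ i - 2 → ω ∈ good K θ j :=
    fun ω hω j h1 h2 => hω.2 j h1 (by omega) (Or.inl (by omega))
  have hgoodR : ∀ ω ∈ A, ∀ j, i + 2 ≤ j → j ≤ b → ω ∈ good K θ j :=
    fun ω hω j h1 h2 => hω.2 j (by omega) h2 (Or.inr h1)
  -- positions of `𝐂⁻`, `𝐂⁺`
  have hposL : ∀ ω, ∀ x ∈ (Ψ ω).1, -(C : ℤ) * K ≤ x ∧ x < (K : ℤ) * (i - 1) := by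
    intro ω x hx
    have := chainCluster_subset K θ a (i - 2) ω hx
    rw [chainSites, Finset.mem_Ico] at this
    constructor <;> nlinarith [this.1, this.2]
  have hposR : ∀ ω, ∀ y ∈ (Ψ ω).2, (K : ℤ) * (i + 1) ≤ y ∧ y < (C : ℤ) * K := by
    intro ω y hy
    have := chainCluster_subset K θ (i + 2) b ω hy
    rw [chainSites, Finset.mem_Ico] at this
    constructor <;> nlinarith [this.1, this.2]
  have hK1 : (1 : ℤ) ≤ K := by exact_mod_cast hK
  -- hypotheses of the decomposition
  have hdet : ∀ bb, DeterminedBy (A ∩ Ψ ⁻¹' {bb}) (↑F : Set (Sym2 ℤ)) := fun bb => by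
    rw [hFcoe]
    exact (determinedBy_isolBad K θ C (by omega) (by omega)).inter_preimage_singleton
      (fun ω => chainCluster_pair_inter_eq hi3 hi4 ω) bb
  have hEdet : ∀ bb : Finset ℤ × Finset ℤ, DeterminedBy (E bb)
      (↑((bb.1 ×ˢ bb.2).image fun q : ℤ × ℤ => s(q.1, q.2)) : Set (Sym2 ℤ)) :=
    fun bb => determinedBy_forall_mk_notMem bb.1 bb.2
  have hEm : ∀ bb, MeasurableSet (E bb) := fun bb => (hEdet bb).measurableSet_of_finset
  have hEc : ∀ bb, (A ∩ Ψ ⁻¹' {bb}).Nonempty → DeterminedBy (E bb) (↑F : Set (Sym2 ℤ))ᶜ := by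
    rintro bb ⟨ω₀, hω₀A, hω₀⟩
    rw [Set.mem_preimage, Set.mem_singleton_iff] at hω₀
    refine (hEdet bb).mono ?_
    intro z hz hzF
    rw [Finset.mem_coe, Finset.mem_image] at hz
    obtain ⟨⟨x, y⟩, hxy, rfl⟩ := hz
    rw [Finset.mem_product] at hxy
    rw [← hω₀] at hxy
    obtain ⟨hx1, hx2⟩ := hposL ω₀ x hxy.1
    obtain ⟨hy1, hy2⟩ := hposR ω₀ y hxy.2
    rw [hFcoe] at hzF
    obtain ⟨j, -, -, hj⟩ := hzF
    rw [mk_mem_blkEdges, mem_blk, mem_blk] at hj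
    nlinarith [hj.1.1, hj.1.2, hj.2.1, hj.2.2]
  -- the uniform conditional bound
  have hqω : ∀ ω ∈ A, (longRangePercolation (anFamily β hβ p)).real (E (Ψ ω)) ≤ q := by
    intro ω hω
    have hST : ∀ x ∈ (Ψ ω).1, ∀ y ∈ (Ψ ω).2, x + 2 ≤ y := by
      intro x hx y hy
      nlinarith [(hposL ω x hx).2, (hposR ω y hy).1]
    -- block structure of `𝐂⁻`, `𝐂⁺`
    have hblock : θ ^ 2 * Λ ≤ ∑ x ∈ (Ψ ω).1, ∑ y ∈ (Ψ ω).2, 1 / ((y : ℝ) - x) ^ 2 := by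
      refine sq_mul_pairSum_le_blockSum hK (by linarith) i
        (fun m => blkCluster ω K (i - 2 - 2 * m) (goodWitness K θ (i - 2 - 2 * m) ω))
        (fun m => blkCluster ω K (i + 2 + 2 * m) (goodWitness K θ (i + 2 + 2 * m) ω)) ?_ ?_ ?_ ?_
      · intro m hm
        have hm' : 2 * (m : ℤ) ≤ (C : ℤ) + i - 3 := by
          have : (m : ℤ) + 1 ≤ N := by exact_mod_cast hm
          have := le_abs_self i; have := neg_abs_le i; omega
        refine Finset.subset_inter ?_ ?_
        · exact blkCluster_subset_chainCluster hK hθ (hgoodL ω hω) (by omega) (by omega)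
        · intro x hx
          have := mem_blk.1 (locCluster_subset ω _ _ _ hx)
          rw [Finset.mem_Ico]
          constructor <;> nlinarith [this.1, this.2]
      · intro m hm
        have hm' : 2 * (m : ℤ) ≤ (C : ℤ) - i - 3 := by
          have : (m : ℤ) + 1 ≤ N := by exact_mod_cast hm
          have := le_abs_self i; have := neg_abs_le i; omega
        refine Finset.subset_inter ?_ ?_
        · exact blkCluster_subset_chainCluster hK hθ (hgoodR ω hω) (by omega) (by omega)
        · intro y hy
          have := mem_blk.1 (locCluster_subset ω _ _ _ hy)
          rw [Finset.mem_Ico]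
          constructor <;> nlinarith [this.1, this.2]
      · intro m hm
        have hm' : 2 * (m : ℤ) ≤ (C : ℤ) + i - 3 := by
          have : (m : ℤ) + 1 ≤ N := by exact_mod_cast hm
          have := le_abs_self i; have := neg_abs_le i; omega
        exact (goodWitness_spec (hgoodL ω hω _ (by omega) (by omega))).2
      · intro m hm
        have hm' : 2 * (m : ℤ) ≤ (C : ℤ) - i - 3 := by
          have : (m : ℤ) + 1 ≤ N := by exact_mod_cast hm
          have := le_abs_self i; have := neg_abs_le i; omega
        exact (goodWitness_spec (hgoodR ω hω _ (by omega) (by omega))).2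
    rw [show E (Ψ ω) = {ω' | ∀ x ∈ (Ψ ω).1, ∀ y ∈ (Ψ ω).2, s(x, y) ∉ ω'} from rfl,
      real_forall_mk_notMem_eq_exp β hβ p hST, hq, Real.exp_le_exp, neg_le_neg_iff]
    calc β * θ ^ 2 * Λ = β * (θ ^ 2 * Λ) := by ring
      _ ≤ β * ∑ x ∈ (Ψ ω).1, ∑ y ∈ (Ψ ω).2, 1 / ((y : ℝ) - x) ^ 2 :=
          mul_le_mul_of_nonneg_left hblock hβ
  have hq0 : 0 ≤ q := (Real.exp_pos _).le
  calc (longRangePercolation (anFamily β hβ p)).real (A ∩ bad (C * K) (θ - C₀ / C) 0)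
      ≤ (longRangePercolation (anFamily β hβ p)).real (A ∩ {ω | ω ∈ E (Ψ ω)}) :=
        measureReal_mono hsub
    _ ≤ q * (longRangePercolation (anFamily β hβ p)).real A := by
        unfold longRangePercolation
        exact prodBernoulli_real_inter_memDep_le _ F Ψ E hdet hEc hEm hqω
    _ ≤ q * (longRangePercolation (anFamily β hβ p)).real (bad K θ i) :=
        mul_le_mul_of_nonneg_left (measureReal_mono Set.inter_subset_left) hq0

/-! ### Two disjoint bad blocks -/

/-- Edge sets of disjoint blocks are disjoint. [folklore] -/
theorem disjoint_blkEdges {K : ℕ} {j j' : ℤ} (h : j + 2 ≤ j') : Disjoint (blkEdges K j) (blkEdges K j') := by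
  rw [Set.disjoint_left]
  intro z hz hz'
  induction z using Sym2.ind with
  | h a b =>
    rw [mk_mem_blkEdges] at hz hz'
    exact Finset.disjoint_left.1 (disjoint_blk h) hz.1 hz'.1

/-- **Two disjoint bad blocks** (DGT (2.5): "By independence and the union bound,
`ℙ[there are two disjoint θ-bad K-blocks] ≤ binom(2C-1, 2) p(K,θ)²`"): if every `K`-block is
`θ`-bad with probability at most `u`, then `P[twoBad K θ C] ≤ 4C² u²` (we bound the number of
pairs by `(2C-1)² ≤ 4C²`). [cite: DuminilcopinGarbanTassion2024, §2.3 (proof of Lemma 2, (2.5))] -/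
theorem real_twoBad_le (Kf : ℕ → unitInterval) (K : ℕ) (θ : ℝ) (C : ℕ) {u : ℝ}
    (hu : ∀ j : ℤ, (longRangePercolation Kf).real (bad K θ j) ≤ u) :
    (longRangePercolation Kf).real (twoBad K θ C) ≤ 4 * (C : ℝ) ^ 2 * u ^ 2 := by
  set μ := longRangePercolation Kf with hμ
  haveI : IsProbabilityMeasure μ := instIsProbabilityMeasureLongRangePercolation Kf
  have hu0 : 0 ≤ u := measureReal_nonneg.trans (hu 0)
  set Iv : Finset ℤ := Finset.Icc (-(C : ℤ) + 1) ((C : ℤ) - 1) with hI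
  set P : Finset (ℤ × ℤ) := (Iv ×ˢ Iv).filter fun jj => jj.1 + 2 ≤ jj.2 with hP
  have hcover : twoBad K θ C ⊆ ⋃ jj ∈ P, (bad K θ jj.1 ∩ bad K θ jj.2) := by
    rintro ω ⟨j, j', h1, h2, h3, hj, hj'⟩
    refine Set.mem_iUnion₂.2 ⟨(j, j'), ?_, hj, hj'⟩
    rw [hP, Finset.mem_filter, Finset.mem_product, hI, Finset.mem_Icc, Finset.mem_Icc]
    exact ⟨⟨⟨h1, by omega⟩, ⟨by omega, h3⟩⟩, h2⟩
  have hterm : ∀ jj ∈ P, μ.real (bad K θ jj.1 ∩ bad K θ jj.2) ≤ u ^ 2 := by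
    intro jj hjj
    rw [hP, Finset.mem_filter] at hjj
    have hind : μ.real (bad K θ jj.1 ∩ bad K θ jj.2) = μ.real (bad K θ jj.1) * μ.real (bad K θ jj.2) := by
      rw [hμ]; unfold longRangePercolation
      refine prodBernoulli_real_inter_of_determinedBy_disjoint _
        (F := (blkEdges_finite K jj.1).toFinset) (F' := (blkEdges_finite K jj.2).toFinset) ?_ ?_ ?_
        (measurableSet_bad K θ _) (measurableSet_bad K θ _)
      · exact Set.Finite.disjoint_toFinset.2 (disjoint_blkEdges hjj.2)
      · rw [Set.Finite.coe_toFinset]; exact determinedBy_bad K θ _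
      · rw [Set.Finite.coe_toFinset]; exact determinedBy_bad K θ _
    rw [hind, sq]
    exact mul_le_mul (hu _) (hu _) measureReal_nonneg hu0
  have hcardI : Iv.card ≤ 2 * C := by
    rw [hI, Int.card_Icc]; omega
  have hcardP : (P.card : ℝ) ≤ 4 * (C : ℝ) ^ 2 := by
    have h1 : P.card ≤ (Iv ×ˢ Iv).card := Finset.card_filter_le _ _
    rw [Finset.card_product] at h1
    have h2 : (Iv ×ˢ Iv).card ≤ (2 * C) * (2 * C) := by
      rw [Finset.card_product]; exact Nat.mul_le_mul hcardI hcardI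
    have : (P.card : ℝ) ≤ ((2 * C) * (2 * C) : ℕ) := by
      rw [Finset.card_product] at h2; exact_mod_cast h1.trans h2
    push_cast at this
    linarith
  calc μ.real (twoBad K θ C) ≤ μ.real (⋃ jj ∈ P, (bad K θ jj.1 ∩ bad K θ jj.2)) :=
        measureReal_mono hcover (measure_ne_top μ _)
    _ ≤ ∑ jj ∈ P, μ.real (bad K θ jj.1 ∩ bad K θ jj.2) := measureReal_biUnion_finset_le P _
    _ ≤ ∑ _jj ∈ P, u ^ 2 := Finset.sum_le_sum hterm
    _ = P.card * u ^ 2 := by rw [Finset.sum_const, nsmul_eq_mul]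
    _ ≤ 4 * (C : ℝ) ^ 2 * u ^ 2 := mul_le_mul_of_nonneg_right hcardP (sq_nonneg u)

end Literature.Barriers.CriticalPhenomena

end
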